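import Literature.NumberTheory.Automorphic.GL2EllipticSplitClassVanishing
import Literature.NumberTheory.Automorphic.GL2EllipticCompactSupport
import Literature.NumberTheory.Automorphic.QuaternionGLTwoClassBijection
import HarnessLib

/-!
# The elliptic classes of `GL₂(K)` split at a finite place drop out of the geometric side
# (Gelbart (1975), §10, p. 155, (10.17)–(10.22))

Topic `NumberTheory/Automorphic`; theorems only (no definition, no named fact, no instance visible to
importers).

Gelbart (1975), p. 155, comparing the geometric sides (10.14) (for `G' = Dˣ`) and (10.15) (for
`G = GL₂`): the elliptic terms of (10.15) are indexed by the quadratic extensions `L` of the ground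
field, those of (10.14) only by the `L` which embed in `D`, i.e. "which do not split at any `v ∈ S`"
(10.17); for the remaining `L` "the corresponding integral (10.19) vanishes", because its local factor
at a place `v ∈ S` where `L` splits is (10.22) `∫_{Z_v \ G_v} (π_v(x_v⁻¹ γ x_v) u_v, u_v) dx_v = 0`, the
test function being a supercusp form at `v` (10.16).

This file glues the single-class vanishing `GL2.integral_descConj_toAdelic_eq_zero_of_isSquare`
(`GL2EllipticSplitClassVanishing`, (10.19) + (10.22)) into the elliptic part of the geometric side
of the trace formula for `GL₂` as produced by `GL2.integral_conjTsum_elliptic_eq_tsum`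
(`GL2EllipticCompactSupport`, Gelbart Prop. 9.10 / Thm. 9.22 (ii)):

* `GLn.inv_mul_toAdelic_mul_of_mem_center'`, `GLn.integral_center'_factorizable` — the central
  average `Φ_A(g) = ∫_{A_G} Φ(z⁻¹ g) dα(z)` of a test function factorizable at `v`,
  `Φ(ι_v(a) k) = ξ(a) Θ(k)`, is again factorizable at `v` with the same local factor:
  `Φ_A(ι_v(a) k) = ξ(a) Θ_A(k)`, `Θ_A(k) = ∫_{A_G} Θ(z⁻¹ k) dα(z)` (`A_G = ℝ_{>0} ≤ G^{(v)}`,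
  `GLn.center'_le_ker_toLocalAt`, and `A_G` is central).
* `GL2.integral_conjTsum_elliptic_eq_zero_of_isSquare` — **the vanishing of the split elliptic
  part**: if every class of `𝒞` is represented by some `γ ∈ GL₂(K)` with irreducible characteristic
  polynomial whose discriminant `tr(γ)² - 4 det(γ)` is a square in `K_v` for some `v ∈ S` (`S` a set
  of finite places), then for every `Φ ∈ C_c(GL₂(𝔸_K))` factorizable at each `v ∈ S` with continuous
  supercusp local factors `ξ_v`,
  `∫_X Σ'_{γ ∈ GL₂(K), [γ] ∈ 𝒞} Φ_A(x̃ γ x̃⁻¹) dμ(x) = 0`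
  (the class sum is `Σ'_c d_c ∫ Φ_A(y γ_c y⁻¹) dμ_c(y)` and every orbital integral vanishes).
* `exists_isSquare_ramifiedPlaces_of_not_mem_range_quaternionToGLTwoClass` — (10.17) under
  assumption (i) of Remark 10.7 (`D` unramified at infinity): an elliptic class of `GL₂(K)` not
  coming from `Dˣ` splits at some finite place ramified in `D`.

Part of the inline (D-0026) decomposition of
`Literature.NumberTheory.Automorphic.strong_multiplicity_one_quaternionUnits` (Gelbart Thm. 10.5):
in the comparison (10.14) = (10.15) with `f = ⊗ f_v` supercusp at the places of `S ⊇ Ram(D)`, the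
elliptic classes of `GL₂(K)` outside the range of `quaternionToGLTwoClass`
(`QuaternionGLTwoClassBijection`) which split at a finite place of `S` contribute nothing.

## References

* S. Gelbart, *Automorphic forms on adele groups*, Ann. of Math. Studies 83 (1975), §10, p. 155,
  (10.16)–(10.22); Prop. 9.10, Thm. 9.22 (ii) [Gelbart1975].
-/

noncomputable section

open MeasureTheory MeasureTheory.Measure Topology NumberField IsDedekindDomain
open scoped NNReal ENNReal

namespace Literature.NumberTheory.Automorphic

open Literature.MeasureTheory.Group

-- the coset spaces carry Borel σ-algebras supplied locally, not the quotient σ-algebra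
attribute [-instance] Quotient.instMeasurableSpace QuotientGroup.measurableSpace

section CentralAverage

variable {n : ℕ} {K : Type} [Field K] [NumberField K] {v : HeightOneSpectrum (𝓞 K)}

attribute [local instance] adelicBorel borelSpace_adelic

/-- `A_G` is central: `z⁻¹ (ι_v(a) k) = ι_v(a) (z⁻¹ k)` for `z ∈ A_G`. [folklore] -/
theorem GLn.inv_mul_toAdelic_mul_of_mem_center' {z : (AdelicGroupData.gl n K).Adelic}
    (hz : z ∈ (AdelicGroupData.gl n K).center') (a : GL (Fin n) (v.adicCompletion K))
    (k : (AdelicGroupData.gl n K).Adelic) :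
    z⁻¹ * (GLn.toAdelic n K v a * k) = GLn.toAdelic n K v a * (z⁻¹ * k) := by
  have hz' := Subgroup.mem_center_iff.1 (inv_mem ((AdelicGroupData.gl n K).center'_le hz))
  calc z⁻¹ * (GLn.toAdelic n K v a * k) = z⁻¹ * GLn.toAdelic n K v a * k := (mul_assoc _ _ _).symm
    _ = GLn.toAdelic n K v a * z⁻¹ * k := by rw [hz' (GLn.toAdelic n K v a)]
    _ = GLn.toAdelic n K v a * (z⁻¹ * k) := mul_assoc _ _ _

/-- **The central average of a factorizable test function is factorizable, with the same local
factor.** If `Φ(ι_v(a) k) = ξ(a) Θ(k)` for `a ∈ GL_n(K_v)`, `k ∈ G^{(v)}`, then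
`Φ_A(ι_v(a) k) = ∫_{A_G} Φ(z⁻¹ ι_v(a) k) dα(z) = ξ(a) ∫_{A_G} Θ(z⁻¹ k) dα(z)`, since
`A_G = ℝ_{>0} ≤ G^{(v)}` (`GLn.center'_le_ker_toLocalAt`) is central. (Gelbart (1975), p. 155: with
`f = Π_v f_v`, the function entering (10.15) keeps the local factor `f_v` at `v ∈ S`.) [folklore] -/
theorem GLn.integral_center'_factorizable (α : Measure (AdelicGroupData.gl n K).center')
    {Φ : (AdelicGroupData.gl n K).Adelic → ℂ} {ξ : GL (Fin n) (v.adicCompletion K) → ℂ}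
    {Θ : (GLn.toLocalAt n K v).ker → ℂ}
    (hΦ : ∀ (a : GL (Fin n) (v.adicCompletion K)) (k : (GLn.toLocalAt n K v).ker),
      Φ (GLn.toAdelic n K v a * (k : (AdelicGroupData.gl n K).Adelic)) = ξ a * Θ k)
    (a : GL (Fin n) (v.adicCompletion K)) (k : (GLn.toLocalAt n K v).ker) :
    ∫ z, Φ ((z : (AdelicGroupData.gl n K).Adelic)⁻¹ *
        (GLn.toAdelic n K v a * (k : (AdelicGroupData.gl n K).Adelic))) ∂α =
      ξ a * ∫ z, Θ ⟨(z : (AdelicGroupData.gl n K).Adelic)⁻¹ * k,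
        mul_mem (inv_mem (GLn.center'_le_ker_toLocalAt n K v z.2)) k.2⟩ ∂α := by
  rw [← integral_const_mul]
  refine integral_congr_ae (ae_of_all _ fun z => ?_)
  simp only
  rw [GLn.inv_mul_toAdelic_mul_of_mem_center' z.2]
  exact hΦ a ⟨_, _⟩

end CentralAverage

section ClassSum

variable (K : Type) [Field K] [NumberField K] {v : HeightOneSpectrum (𝓞 K)}

local notation "𝔸K" => AdeleRing (𝓞 K) K
local notation "M₂" => Matrix (Fin 2) (Fin 2) K
local notation "G₂" => AdelicGroupData.gl 2 K

attribute [local instance] adelicBorel borelSpace_adelic locallyCompactSpace_adelic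
  secondCountableTopology_gl_adelic

attribute [local instance] AdelicGroupData.measurableSpaceQuotientForm
  AdelicGroupData.borelSpaceQuotientForm AdelicGroupData.smulInvariantMeasureQuotientForm
  AdelicGroupData.isFiniteMeasureOnCompactsQuotientForm AdelicGroupData.isFiniteMeasureQuotientForm

/-- **Gelbart (1975), p. 155, (10.17)–(10.22): the elliptic classes split at a place where the test
function is supercusp contribute nothing to the geometric side for `GL₂`.** Let `μ` be an automorphic
measure on `X = GL₂(𝔸_K) ⧸ ℝ_{>0} GL₂(K)`, `α` a Haar measure on `A_G = ℝ_{>0}`, `S` a set of finite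
places of `K`, and `𝒞` a set of conjugacy classes of `GL₂(K)` each represented by some `γ` of
irreducible characteristic polynomial whose discriminant `tr(γ)² - 4 det(γ)` is a square in `K_v` for
some `v ∈ S` (the quadratic extension `K(γ)` splits at `v`, so does not embed in a quaternion algebra
ramified at `v`, (10.17)). Then for every `Φ ∈ C_c(GL₂(𝔸_K))` factorizable at each `v ∈ S`,
`Φ(ι_v(a) k) = ξ_v(a) Θ_v(k)`, with continuous supercusp local factors `ξ_v`
(`∫ ξ_v(a n(x) b) dx = 0`, (10.16)), the `𝒞`-part of the geometric side vanishes: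
`∫_X Σ'_{γ ∈ GL₂(K), [γ] ∈ 𝒞} Φ_A(x̃ γ x̃⁻¹) dμ(x) = 0`, `Φ_A(g) = ∫_{A_G} Φ(z⁻¹ g) dα(z)`.
Proof: the class sum equals `Σ'_c d_c ∫_{GL₂(𝔸_K) ⧸ C(γ_c)} Φ_A(y γ_c y⁻¹) dμ_c(y)`
(`GL2.integral_conjTsum_elliptic_eq_tsum`), `Φ_A` is factorizable at `v` with local factor `ξ_v`
(`GLn.integral_center'_factorizable`), and each orbital integral vanishes by (10.19) + (10.22) at a
place `v ∈ S` where the class splits (`GL2.integral_descConj_toAdelic_eq_zero_of_isSquare`). The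
local fields `K_v` enter through instance hypotheses, as elsewhere in the tree.
[cite: Gelbart1975, p. 155 (10.17)–(10.22)] -/
theorem GL2.integral_conjTsum_elliptic_eq_zero_of_isSquare
    [∀ v : HeightOneSpectrum (𝓞 K), ValuativeRel (v.adicCompletion K)]
    [∀ v : HeightOneSpectrum (𝓞 K), IsNonarchimedeanLocalField (v.adicCompletion K)]
    [∀ v : HeightOneSpectrum (𝓞 K), MeasurableSpace (v.adicCompletion K)]
    [∀ v : HeightOneSpectrum (𝓞 K), BorelSpace (v.adicCompletion K)]
    [∀ v : HeightOneSpectrum (𝓞 K), MeasurableSpace (GL (Fin 2) (v.adicCompletion K))]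
    [∀ v : HeightOneSpectrum (𝓞 K), BorelSpace (GL (Fin 2) (v.adicCompletion K))]
    [∀ v : HeightOneSpectrum (𝓞 K), SecondCountableTopology (GL (Fin 2) (v.adicCompletion K))]
    [∀ γ : (G₂).Adelic, MeasurableSpace ((G₂).Adelic ⧸
      Subgroup.centralizer ({γ} : Set (G₂).Adelic))]
    [∀ γ : (G₂).Adelic, BorelSpace ((G₂).Adelic ⧸ Subgroup.centralizer ({γ} : Set (G₂).Adelic))]
    [∀ γ : (G₂).Adelic, MeasurableSpace ((G₂).Adelic ⧸ ((G₂).quotientSubgroup ⊓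
      Subgroup.centralizer ({γ} : Set (G₂).Adelic)))]
    [∀ γ : (G₂).Adelic, BorelSpace ((G₂).Adelic ⧸ ((G₂).quotientSubgroup ⊓
      Subgroup.centralizer ({γ} : Set (G₂).Adelic)))]
    (μ : Measure (G₂).automorphicQuotient) [(G₂).IsAutomorphicMeasure μ]
    (S : Set (HeightOneSpectrum (𝓞 K))) (𝒞 : Set (ConjClasses (G₂).arithmeticSubgroup))
    (h𝒞 : ∀ c ∈ 𝒞, ∃ g : GL (Fin 2) K, Matrix.GeneralLinearGroup.map (algebraMap K 𝔸K) g =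
      ((Quotient.out c : (G₂).arithmeticSubgroup) : (G₂).Adelic) ∧
        Irreducible (Matrix.charpoly (g : M₂)) ∧
        ∃ v ∈ S, IsSquare (algebraMap K (v.adicCompletion K)
          ((g : M₂).trace ^ 2 - 4 * (g : M₂).det)))
    (α : Measure (G₂).center') [α.IsHaarMeasure] [SFinite α]
    (Φ : CompactlySupportedContinuousMap (G₂).Adelic ℂ)
    (hΦ : ∀ v ∈ S, ∃ (ξ : GL (Fin 2) (v.adicCompletion K) → ℂ) (Θ : (GLn.toLocalAt 2 K v).ker → ℂ),
      (∀ (a : GL (Fin 2) (v.adicCompletion K)) (k : (GLn.toLocalAt 2 K v).ker),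
        Φ (GLn.toAdelic 2 K v a * (k : (G₂).Adelic)) = ξ a * Θ k) ∧
      Continuous ξ ∧
      ∀ (dx : Measure (v.adicCompletion K)) [dx.IsAddHaarMeasure]
        (a b : GL (Fin 2) (v.adicCompletion K)),
        ∫ x, ξ (a * ((unipotentGL2 x : ↥(upperUnitriangular (Fin 2) (v.adicCompletion K))) :
          GL (Fin 2) (v.adicCompletion K)) * b) ∂dx = 0) :
    ∫ x, conjTsum (G₂).quotientSubgroup
        (((↑) : (G₂).arithmeticSubgroup → (G₂).Adelic) ''
          {γ : (G₂).arithmeticSubgroup | ConjClasses.mk γ ∈ 𝒞})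
        (conj_mem_of_mk_mem (G₂).arithmeticSubgroup 𝒞 (G₂).quotientSubgroup
          (AdelicGroupData.exists_inv_mul_mem_centralizer_quotientSubgroup (G₂)))
        (fun g => ∫ a, Φ ((a : (G₂).Adelic)⁻¹ * g) ∂α) x ∂μ = 0 := by
  obtain ⟨d, μC, -, hμC, hmain⟩ := GL2.integral_conjTsum_elliptic_eq_tsum K μ 𝒞
    (fun c hc => by
      obtain ⟨g, hg, hirr, -⟩ := h𝒞 c hc
      exact ⟨g, hg, hirr⟩) α
  obtain ⟨-, -, -, hEq⟩ := hmain Φ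
  rw [hEq]
  -- the representative `γ_c = out c` is the diagonal image of some elliptic `g ∈ GL₂(K)` split at
  -- some `v ∈ S`, where `Φ_A` is factorizable with supercusp local factor
  have key : ∀ (g : GL (Fin 2) K), Irreducible (Matrix.charpoly (g : M₂)) →
      ∀ v ∈ S, IsSquare (algebraMap K (v.adicCompletion K) ((g : M₂).trace ^ 2 - 4 * (g : M₂).det)) →
      ∀ (x : (G₂).Adelic), (G₂).toAdelic g = x →
      ∀ (m : Measure ((G₂).Adelic ⧸ Subgroup.centralizer ({x} : Set (G₂).Adelic))),
      SMulInvariantMeasure (G₂).Adelic _ m → IsFiniteMeasureOnCompacts m →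
      ∫ y, descConj x (Subgroup.centralizer ({x} : Set (G₂).Adelic))
        (mem_centralizer_singleton_comm _)
        (fun g => ∫ a, Φ ((a : (G₂).Adelic)⁻¹ * g) ∂α) y ∂m = 0 := by
    rintro g hirr v hv hsq x rfl m hm1 hm2
    obtain ⟨ξ, Θ, hΦv, hξc, hξ⟩ := hΦ v hv
    exact GL2.integral_descConj_toAdelic_eq_zero_of_isSquare (v := v) g hirr hsq m
      (Θ := fun k => ∫ z, Θ ⟨(z : (G₂).Adelic)⁻¹ * k,
        mul_mem (inv_mem (GLn.center'_le_ker_toLocalAt 2 K v z.2)) k.2⟩ ∂α)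
      (GLn.integral_center'_factorizable α hΦv) hξc hξ
  have hterm : ∀ c : 𝒞, ((d c).toReal : ℂ) * ∫ y, descConj
      ((Quotient.out (c : ConjClasses (G₂).arithmeticSubgroup) : (G₂).arithmeticSubgroup) :
        (G₂).Adelic)
      (Subgroup.centralizer ({((Quotient.out (c : ConjClasses (G₂).arithmeticSubgroup) :
        (G₂).arithmeticSubgroup) : (G₂).Adelic)} : Set (G₂).Adelic))
      (mem_centralizer_singleton_comm _)
      (fun g => ∫ a, Φ ((a : (G₂).Adelic)⁻¹ * g) ∂α) y ∂(μC c) = 0 := by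
    intro c
    obtain ⟨g, hg, hirr, v, hv, hsq⟩ := h𝒞 c c.2
    obtain ⟨h1, h2, -⟩ := hμC c
    rw [key g hirr v hv hsq _ hg (μC c) h1 h2, mul_zero]
  calc _ = ∑' _ : 𝒞, (0 : ℂ) := tsum_congr hterm
    _ = 0 := tsum_zero

end ClassSum

section Ramified

universe u

variable (K : Type) [Field K] [NumberField K] (D : Type u) [Ring D] [Algebra K D] [IsQuaternionAlgebra K D]

/-- **Gelbart's (10.17), contrapositive form, under assumption (i) of Remark 10.7** ("the set of
ramified primes in `D` does not include infinite primes", p. 155): if `D` is unramified at every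
infinite place, an elliptic class `[γ]` of `GL₂(K)` which does not come from `Dˣ` (is not in the range
of `quaternionToGLTwoClass`) splits at some finite place ramified in `D`: `tr(γ)² - 4 det(γ)` is a
square in `K_v` for some `v ∈ Ram_f(D)` (`mk_mem_range_quaternionToGLTwoClass_of_not_isSquare_ramified`).
These are exactly the classes removed by `GL2.integral_conjTsum_elliptic_eq_zero_of_isSquare` with
`S ⊇ Ram_f(D)`. [cite: Gelbart1975, p. 154 (10.17), p. 155 Remark 10.7 (i)] -/
theorem exists_isSquare_ramifiedPlaces_of_not_mem_range_quaternionToGLTwoClass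
    (hD : ramifiedInfinitePlaces K D = ∅) (γ : GL (Fin 2) K)
    (hirr : Irreducible (γ : Matrix (Fin 2) (Fin 2) K).charpoly)
    (hγ : ConjClasses.mk γ ∉ Set.range (quaternionToGLTwoClass K D)) :
    ∃ v ∈ ramifiedPlaces K D, IsSquare (algebraMap K (v.adicCompletion K)
      ((γ : Matrix (Fin 2) (Fin 2) K).trace ^ 2 - 4 * (γ : Matrix (Fin 2) (Fin 2) K).det)) := by
  by_contra h
  push Not at h
  exact hγ (mk_mem_range_quaternionToGLTwoClass_of_not_isSquare_ramified K D γ hirr h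
    (fun w hw => by simp [hD] at hw))

end Ramified

end Literature.NumberTheory.Automorphic
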